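import Mathlib.MeasureTheory.Measure.MeasuredSets
import Mathlib.MeasureTheory.OuterMeasure.BorelCantelli
import Literature.Probability.Process.BlumenthalZeroOne
import Literature.Probability.Process.BrownianPair
import HarnessLib

/-!
# The zero-one law for scale-invariant events of a Brownian motion

Topic: Probability / stochastic processes. For a pre-Brownian motion `B` (Mathlib
`ProbabilityTheory.IsPreBrownianReal`) on `(Ω, P)` with measurable marginals, continuous paths and
`B 0 = 0`, and a measurable set of paths `S ⊆ (ℝ≥0 → ℝ)` (product σ-algebra) which is
**invariant under Brownian scaling along the sample paths** — for every `0 < c < 1` and every `ω`,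
the rescaled path `t ↦ (√c)⁻¹ B_{ct}(ω)` lies in `S` iff the path `t ↦ B_t(ω)` does — the event
`{ω | B(ω) ∈ S}` has probability `0` or `1`:
`ProbabilityTheory.IsPreBrownianReal.measure_zero_or_one_of_scaleInvariant` (**proved**).

This is the zero-one law behind "the scaling transformation `B ↦ (c^{-1/2} B_{c·})` of Brownian
motion is ergodic for `c ≠ 1`" (Chaumont–Yor, *Exercises in Probability* (2003), comment (b) on
Exercise 1.8, and Exercise 5.17 for stable processes): ergodicity is exactly the triviality of the
invariant σ-field. It is the form used for almost-sure *dichotomies* of scale-invariant path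
properties of SLE_κ (the Loewner chain of `√κ B` is generated by a curve, is simple, hits the
real line, …), cf. `Literature/Probability/RandomPlanarGeometry/SLETraceZeroOne.lean`.

Proof (reduction to Blumenthal's zero-one law, `BlumenthalZeroOne.lean`). Let `E = {B ∈ S}`.
(1) `exists_cylinder_symmDiff_lt`: every event of `σ(B)` is, up to a set of measure `< ε`, an
event `A = {(B_j)_{j ≤ n} ∈ A₀}` of the natural filtration at some finite time `n` — the events of
`⋃ₙ 𝓕ₙ` form a ring generating `σ(B)` (on path space: the product σ-algebra), and Mathlib's
`MeasureTheory.exists_measure_symmDiff_lt_of_generateFrom_isSetRing` applies to the law of the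
path. (2) For `s > 0` pick `0 < c < 1` with `c n ≤ s`; the *rescaled* event
`A' = {((√c)⁻¹ B_{cj})_{j ≤ n} ∈ A₀}` belongs to `𝓕_s`, and since `E` is also the event
`{B^{(c)} ∈ S}` for the rescaled motion `B^{(c)}_t = (√c)⁻¹ B_{ct}` (invariance), which has the
same law on path space as `B` (Mathlib `IsPreBrownianReal.smul`, and
`IsPreBrownianReal.map_path_eq`), `P (A' ∆ E) = P (A ∆ E) < ε`. (3) With `ε = 2⁻ᵏ` and
Borel–Cantelli (Mathlib `MeasureTheory.ae_eventually_notMem`), `E` coincides a.s. with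
`limsupₖ A'ₖ ∈ 𝓕_s`. (4) So `E` is a.s. equal to a germ event for every `s > 0`, and
Blumenthal's zero-one law (`IsPreBrownianReal.measure_zero_or_one_of_germ`) gives `P E ∈ {0, 1}`.

## Mathlib

We USE `ProbabilityTheory.IsPreBrownianReal.smul` (Brownian scaling),
`MeasureTheory.exists_measure_symmDiff_lt_of_generateFrom_isSetRing` (approximation by a
generating ring), `MeasureTheory.ae_eventually_notMem` (Borel–Cantelli),
`MeasurableSet.measurableSet_limsup`, `Filter.mem_limsup_iff_frequently_mem`. Mathlib has no
ergodicity statement for Brownian scaling (searched `scaleInvariant`, `ergodic` + `rownian`).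

## References

* L. Chaumont, M. Yor, *Exercises in Probability*, Cambridge Univ. Press (2003), Exercise 1.8
  and comment (b) p. 8 ("the scaling operation `B ↦ (c^{-1/2} B_c)` is ergodic for `c ≠ 1`"),
  Exercise 5.17.
* D. Revuz, M. Yor, *Continuous Martingales and Brownian Motion*, 3rd ed. (1999), Ch. I
  Prop. (1.10) (scaling invariance), Ch. III Thm. (2.15) (Blumenthal's zero-one law).
-/

noncomputable section

open Set Filter MeasureTheory ProbabilityTheory Topology
open scoped NNReal ENNReal symmDiff

namespace Literature.Probability.Process

/-! ### Events of the natural filtration at finite times approximate every event of `σ(B)` -/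

section Cylinder

/-- The σ-algebras `σ(f_j, j ≤ s)` on raw path space `ℝ≥0 → ℝ` (pull-backs of the product
σ-algebra under restriction to the times `≤ s`) increase with `s`. [folklore] -/
theorem comap_restrict_Iic_mono {s s' : ℝ≥0} (h : s ≤ s') :
    MeasurableSpace.comap (fun (f : ℝ≥0 → ℝ) (j : Iic s) ↦ f j)
        (inferInstance : MeasurableSpace (Iic s → ℝ)) ≤
      MeasurableSpace.comap (fun (f : ℝ≥0 → ℝ) (j : Iic s') ↦ f j)
        (inferInstance : MeasurableSpace (Iic s' → ℝ)) := by
  set π : (Iic s' → ℝ) → (Iic s → ℝ) := fun g j ↦ g ⟨j, j.2.trans h⟩ with hπ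
  have hπm : Measurable π := measurable_pi_lambda _ fun _ ↦ measurable_pi_apply _
  have hcomp : (fun (f : ℝ≥0 → ℝ) (j : Iic s) ↦ f j) = π ∘ fun (f : ℝ≥0 → ℝ) (j : Iic s') ↦ f j :=
    rfl
  rw [hcomp, ← MeasurableSpace.comap_comp]
  exact MeasurableSpace.comap_mono hπm.comap_le

/-- **The cylinder ring generates the product σ-algebra.** On raw path space `ℝ≥0 → ℝ` the sets
measurable with respect to `σ(f_j, j ≤ n)` for some `n : ℕ` (the events of the natural filtration
at finite times) form a ring of sets containing the whole space and generating the product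
σ-algebra. Billingsley (1999), Example 1.3 (the class `𝒞_f`, `σ(𝒞_f) = 𝒞`). [folklore] -/
theorem isSetRing_and_generateFrom_cylinder :
    IsSetRing (⋃ n : ℕ, {T : Set (ℝ≥0 → ℝ) |
      MeasurableSet[MeasurableSpace.comap (fun (f : ℝ≥0 → ℝ) (j : Iic (n : ℝ≥0)) ↦ f j)
        inferInstance] T}) ∧
    (univ : Set (ℝ≥0 → ℝ)) ∈ (⋃ n : ℕ, {T : Set (ℝ≥0 → ℝ) |
      MeasurableSet[MeasurableSpace.comap (fun (f : ℝ≥0 → ℝ) (j : Iic (n : ℝ≥0)) ↦ f j)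
        inferInstance] T}) ∧
    MeasurableSpace.generateFrom (⋃ n : ℕ, {T : Set (ℝ≥0 → ℝ) |
      MeasurableSet[MeasurableSpace.comap (fun (f : ℝ≥0 → ℝ) (j : Iic (n : ℝ≥0)) ↦ f j)
        inferInstance] T}) = (MeasurableSpace.pi : MeasurableSpace (ℝ≥0 → ℝ)) := by
  set F : ℕ → MeasurableSpace (ℝ≥0 → ℝ) := fun n ↦
    MeasurableSpace.comap (fun (f : ℝ≥0 → ℝ) (j : Iic (n : ℝ≥0)) ↦ f j) inferInstance with hF
  set C : Set (Set (ℝ≥0 → ℝ)) := ⋃ n : ℕ, {T | MeasurableSet[F n] T} with hC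
  have hmem : ∀ {T}, T ∈ C ↔ ∃ n, MeasurableSet[F n] T := fun {T} ↦ by
    simp only [hC, mem_iUnion, mem_setOf_eq]
  have hmono : ∀ {k n : ℕ}, k ≤ n → F k ≤ F n := fun {k n} hkn ↦
    comap_restrict_Iic_mono (by exact_mod_cast hkn)
  have hFle : ∀ n, F n ≤ MeasurableSpace.pi := fun n ↦
    (measurable_pi_lambda _ fun _ ↦ measurable_pi_apply _).comap_le
  refine ⟨⟨hmem.2 ⟨0, @MeasurableSet.empty _ (F 0)⟩, ?_, ?_⟩, hmem.2 ⟨0, @MeasurableSet.univ _ (F 0)⟩,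
    le_antisymm (MeasurableSpace.generateFrom_le ?_) ?_⟩
  · intro s t hs ht
    obtain ⟨k, hk⟩ := hmem.1 hs
    obtain ⟨n, hn⟩ := hmem.1 ht
    exact hmem.2 ⟨max k n, (hmono (le_max_left k n) _ hk).union (hmono (le_max_right k n) _ hn)⟩
  · intro s t hs ht
    obtain ⟨k, hk⟩ := hmem.1 hs
    obtain ⟨n, hn⟩ := hmem.1 ht
    exact hmem.2 ⟨max k n, (hmono (le_max_left k n) _ hk).diff (hmono (le_max_right k n) _ hn)⟩
  · intro T hT
    obtain ⟨n, hn⟩ := hmem.1 hT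
    exact hFle n _ hn
  · -- every coordinate is measurable for `generateFrom C`
    have hres : ∀ n : ℕ, Measurable[MeasurableSpace.generateFrom C, inferInstance]
        (fun (f : ℝ≥0 → ℝ) (j : Iic (n : ℝ≥0)) ↦ f j) := fun n ↦
      measurable_iff_comap_le.2 fun _T hT ↦
        MeasurableSpace.measurableSet_generateFrom (hmem.2 ⟨n, hT⟩)
    have hid : Measurable[MeasurableSpace.generateFrom C, MeasurableSpace.pi]
        (id : (ℝ≥0 → ℝ) → (ℝ≥0 → ℝ)) := by
      rw [@measurable_pi_iff (ℝ≥0 → ℝ) ℝ≥0 (fun _ ↦ ℝ) (MeasurableSpace.generateFrom C)]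
      intro t
      obtain ⟨n, hn⟩ := exists_nat_ge t
      have hcomp : (fun f : ℝ≥0 → ℝ ↦ id f t) =
          (fun g : Iic (n : ℝ≥0) → ℝ ↦ g ⟨t, hn⟩) ∘ fun (f : ℝ≥0 → ℝ) (j : Iic (n : ℝ≥0)) ↦ f j :=
        rfl
      rw [hcomp]
      exact (measurable_pi_apply _).comp (hres n)
    have h := hid.comap_le
    rwa [MeasurableSpace.comap_id] at h

variable {Ω : Type*} {mΩ : MeasurableSpace Ω} {P : Measure Ω} {B : ℝ≥0 → Ω → ℝ}

/-- **Every event of `σ(B)` is approximated by events of the natural filtration at finite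
times.** For a process `B` with measurable marginals under a finite measure `P` and a
measurable set of paths `S`, for every `ε > 0` there are `n : ℕ` and a measurable
`A₀ ⊆ (Iic n → ℝ)` with `P ({(B_j)_{j ≤ n} ∈ A₀} ∆ {B ∈ S}) < ε`. (The ring `⋃ₙ 𝓕ₙ` generates
`σ(B)`; Mathlib `exists_measure_symmDiff_lt_of_generateFrom_isSetRing` applied to the law of the
path.) Billingsley (1999), Example 1.3; Halmos, *Measure Theory*, §13 Thm. D. [folklore] -/
theorem exists_cylinder_symmDiff_lt [IsFiniteMeasure P] (hm : ∀ t, Measurable (B t))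
    {S : Set (ℝ≥0 → ℝ)} (hS : MeasurableSet S) {ε : ℝ≥0∞} (hε : 0 < ε) :
    ∃ (n : ℕ) (A₀ : Set (Iic (n : ℝ≥0) → ℝ)), MeasurableSet A₀ ∧
      P (((fun ω (j : Iic (n : ℝ≥0)) ↦ B j ω) ⁻¹' A₀) ∆ ((fun ω t ↦ B t ω) ⁻¹' S)) < ε := by
  set X : Ω → (ℝ≥0 → ℝ) := fun ω t ↦ B t ω with hX
  have hXm : Measurable X := measurable_pi_lambda _ hm
  obtain ⟨hring, huniv, hgen⟩ := isSetRing_and_generateFrom_cylinder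
  obtain ⟨T, hT, hTε⟩ := exists_measure_symmDiff_lt_of_generateFrom_isSetRing (μ := P.map X)
    hring ⟨{univ}, countable_singleton _, singleton_subset_iff.2 huniv, by simp⟩ hgen.symm hS hε
  obtain ⟨n, hn⟩ := mem_iUnion.1 hT
  obtain ⟨A₀, hA₀, rfl⟩ := MeasurableSpace.measurableSet_comap.1 hn
  refine ⟨n, A₀, hA₀, ?_⟩
  rwa [Measure.map_apply hXm (((measurable_pi_lambda _ fun _ ↦ measurable_pi_apply _) hA₀).symmDiff hS),
    Set.preimage_symmDiff] at hTε

end Cylinder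

/-! ### The zero-one law for scale-invariant events -/

section ScalingZeroOne

variable {Ω : Type*} {mΩ : MeasurableSpace Ω} {P : Measure Ω} {B : ℝ≥0 → Ω → ℝ}

/-- **Scale-invariant events are almost germ events.** Let `B` be a pre-Brownian motion with
measurable marginals and `S` a measurable set of paths, invariant under the Brownian scalings
`t ↦ (√c)⁻¹ B_{ct}` (`0 < c < 1`) along the sample paths. Then for every `s > 0` and `ε > 0` the
event `E = {B ∈ S}` is within `ε` (in `P`-measure of the symmetric difference) of an event of
`𝓕_s = σ(B_j, j ≤ s)`: approximate `E` by `{(B_j)_{j ≤ n} ∈ A₀}` (`exists_cylinder_symmDiff_lt`),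
rescale time by `c ≤ s / (n + 1)`, and use that the rescaled motion has the same law (Mathlib
`IsPreBrownianReal.smul`, `IsPreBrownianReal.map_path_eq`) while `E` is also its `S`-event.
Chaumont–Yor (2003), Ex. 1.8; Revuz–Yor (1999), Ch. I Prop. (1.10). [folklore] -/
theorem _root_.ProbabilityTheory.IsPreBrownianReal.exists_measurableSet_comap_symmDiff_lt_of_scaleInvariant
    (hB : IsPreBrownianReal B P) (hm : ∀ t, Measurable (B t))
    {S : Set (ℝ≥0 → ℝ)} (hS : MeasurableSet S)
    (hinv : ∀ c : ℝ≥0, 0 < c → c < 1 → ∀ ω,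
      (fun t ↦ (√c)⁻¹ * B (c * t) ω) ∈ S ↔ (fun t ↦ B t ω) ∈ S)
    {s : ℝ≥0} (hs : 0 < s) {ε : ℝ≥0∞} (hε : 0 < ε) :
    ∃ A : Set Ω, MeasurableSet[MeasurableSpace.comap (fun ω (j : Iic s) ↦ B j ω) inferInstance] A ∧
      P (A ∆ ((fun ω t ↦ B t ω) ⁻¹' S)) < ε := by
  haveI : IsProbabilityMeasure P := hB.isGaussianProcess.isProbabilityMeasure
  set X : Ω → (ℝ≥0 → ℝ) := fun ω t ↦ B t ω with hX
  have hXm : Measurable X := measurable_pi_lambda _ hm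
  obtain ⟨n, A₀, hA₀, happ⟩ := exists_cylinder_symmDiff_lt (P := P) hm hS hε
  -- the scale `c`
  set c : ℝ≥0 := min 2⁻¹ (s / ((n : ℝ≥0) + 1)) with hc
  have hc0 : 0 < c := lt_min (by norm_num) (div_pos hs (by positivity))
  have hc1 : c < 1 := (min_le_left _ _).trans_lt (by norm_num)
  have hcn : c * (n : ℝ≥0) ≤ s :=
    calc c * (n : ℝ≥0) ≤ s / ((n : ℝ≥0) + 1) * (n : ℝ≥0) := mul_le_mul_left (min_le_right _ _) _
      _ ≤ s / ((n : ℝ≥0) + 1) * ((n : ℝ≥0) + 1) := mul_le_mul_right (le_add_of_nonneg_right zero_le_one) _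
      _ = s := div_mul_cancel₀ _ (by positivity)
  have hcj : ∀ j : Iic (n : ℝ≥0), c * (j : ℝ≥0) ≤ s := fun j ↦
    (mul_le_mul_right (show (j : ℝ≥0) ≤ n from j.2) c).trans hcn
  -- the rescaled cylinder event, an event of `𝓕_s`
  set Φ : (Iic s → ℝ) → (Iic (n : ℝ≥0) → ℝ) := fun g j ↦ (√c)⁻¹ * g ⟨c * j, hcj j⟩ with hΦ
  have hΦm : Measurable Φ := measurable_pi_lambda _ fun _ ↦ (measurable_pi_apply _).const_mul _
  refine ⟨(fun ω (j : Iic s) ↦ B j ω) ⁻¹' (Φ ⁻¹' A₀), ⟨Φ ⁻¹' A₀, hΦm hA₀, rfl⟩, ?_⟩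
  -- the rescaled motion and its law on path space
  set Xc : Ω → (ℝ≥0 → ℝ) := fun ω t ↦ (√c)⁻¹ * B (c * t) ω with hXc
  have hBc : IsPreBrownianReal (fun t ω ↦ (√c)⁻¹ * B (c * t) ω) P := hB.smul hc0.ne'
  have hmc : ∀ t, Measurable fun ω ↦ (√c)⁻¹ * B (c * t) ω := fun t ↦ (hm _).const_mul _
  have hXcm : Measurable Xc := measurable_pi_lambda _ hmc
  have hlaw : P.map Xc = P.map X := hBc.map_path_eq hB hmc hm
  -- both events are preimages under the rescaled path map
  have h1 : (fun ω (j : Iic s) ↦ B j ω) ⁻¹' (Φ ⁻¹' A₀) =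
      Xc ⁻¹' ((fun (f : ℝ≥0 → ℝ) (j : Iic (n : ℝ≥0)) ↦ f j) ⁻¹' A₀) := rfl
  have h2 : X ⁻¹' S = Xc ⁻¹' S := by
    ext ω
    exact (hinv c hc0 hc1 ω).symm
  have h3 : (fun ω (j : Iic (n : ℝ≥0)) ↦ B j ω) ⁻¹' A₀ =
      X ⁻¹' ((fun (f : ℝ≥0 → ℝ) (j : Iic (n : ℝ≥0)) ↦ f j) ⁻¹' A₀) := rfl
  have hD : MeasurableSet (((fun (f : ℝ≥0 → ℝ) (j : Iic (n : ℝ≥0)) ↦ f j) ⁻¹' A₀) ∆ S) :=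
    ((measurable_pi_lambda _ fun _ ↦ measurable_pi_apply _) hA₀).symmDiff hS
  rw [h1, h2, ← Set.preimage_symmDiff, ← Measure.map_apply hXcm hD, hlaw, Measure.map_apply hXm hD,
    Set.preimage_symmDiff, ← h3]
  exact happ

/-- **Zero-one law for scale-invariant events of a Brownian motion.** Let `B` be a pre-Brownian
motion on `(Ω, P)` with measurable marginals, continuous paths and `B 0 = 0`, and let `S` be a
measurable set of paths (`ℝ≥0 → ℝ`, product σ-algebra) such that, for every `0 < c < 1` and
every `ω`, the rescaled path `t ↦ (√c)⁻¹ B_{ct}(ω)` lies in `S` iff `t ↦ B_t(ω)` does. Then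
`P {ω | B(ω) ∈ S} ∈ {0, 1}`. (The invariant σ-field of the Brownian scaling transformations is
trivial: "the scaling operation `B ↦ (c^{-1/2} B_c)` is ergodic for `c ≠ 1`".) Proof: by
`exists_measurableSet_comap_symmDiff_lt_of_scaleInvariant` and Borel–Cantelli the event coincides
a.s. with an event of `𝓕_s` for every `s > 0`, and Blumenthal's zero-one law
(`IsPreBrownianReal.measure_zero_or_one_of_germ`) applies. A dot-notation extension of Mathlib's
`ProbabilityTheory.IsPreBrownianReal`, declared in Mathlib's namespace `ProbabilityTheory` (as
`BlumenthalZeroOne.lean`). Chaumont–Yor, *Exercises in Probability* (2003), Exercise 1.8 and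
comment (b); Revuz–Yor (1999), Ch. III Thm. (2.15). [cite: ChaumontYor2003, Ex. 1.8] -/
theorem _root_.ProbabilityTheory.IsPreBrownianReal.measure_zero_or_one_of_scaleInvariant
    (hB : IsPreBrownianReal B P) (hm : ∀ t, Measurable (B t))
    (hcont : ∀ ω, Continuous (B · ω)) (h0 : ∀ ω, B 0 ω = 0)
    {S : Set (ℝ≥0 → ℝ)} (hS : MeasurableSet S)
    (hinv : ∀ c : ℝ≥0, 0 < c → c < 1 → ∀ ω,
      (fun t ↦ (√c)⁻¹ * B (c * t) ω) ∈ S ↔ (fun t ↦ B t ω) ∈ S) :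
    P ((fun ω t ↦ B t ω) ⁻¹' S) = 0 ∨ P ((fun ω t ↦ B t ω) ⁻¹' S) = 1 := by
  haveI : IsProbabilityMeasure P := hB.isGaussianProcess.isProbabilityMeasure
  set E : Set Ω := (fun ω t ↦ B t ω) ⁻¹' S with hE
  refine hB.measure_zero_or_one_of_germ hm hcont h0 fun s hs ↦ ?_
  -- approximating events of `𝓕_s` at the summable rates `2⁻ᵏ`
  have hpos : ∀ k : ℕ, (0 : ℝ≥0∞) < 2⁻¹ ^ k := fun k ↦
    ENNReal.pow_pos (ENNReal.inv_pos.2 ENNReal.ofNat_ne_top) k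
  choose A hAm hA using fun k : ℕ ↦
    hB.exists_measurableSet_comap_symmDiff_lt_of_scaleInvariant hm hS hinv hs (hpos k)
  refine ⟨Filter.limsup A atTop, @MeasurableSet.measurableSet_limsup Ω
    (MeasurableSpace.comap (fun ω (j : Iic s) ↦ B j ω) inferInstance) A hAm, ?_⟩
  -- Borel–Cantelli: a.s., `ω ∈ A k ↔ ω ∈ E` eventually
  have hsum : ∑' k, P (A k ∆ E) ≠ ∞ := by
    refine ne_top_of_le_ne_top ?_ (ENNReal.tsum_le_tsum fun k ↦ (hA k).le)
    rw [ENNReal.tsum_geometric, ENNReal.one_sub_inv_two, inv_inv]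
    exact ENNReal.ofNat_ne_top
  have hae := ae_eventually_notMem hsum
  rw [Filter.eventuallyEq_set]
  filter_upwards [hae] with ω hω
  rw [Filter.mem_limsup_iff_frequently_mem]
  constructor
  · intro hωE
    have hev : ∀ᶠ k in atTop, ω ∈ A k := hω.mono fun k hk ↦ by
      by_contra hkA
      exact hk (Set.mem_symmDiff.2 (Or.inr ⟨hωE, hkA⟩))
    exact hev.frequently
  · intro hfr
    by_contra hωE
    have hev : ∀ᶠ k in atTop, ω ∉ A k := hω.mono fun k hk hkA ↦
      hk (Set.mem_symmDiff.2 (Or.inl ⟨hkA, hωE⟩))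
    obtain ⟨k, hk1, hk2⟩ := (hev.and_frequently hfr).exists
    exact hk1 hk2

/-- **Zero-one law for scale-invariant events, almost-sure-event form**: under the hypotheses of
`IsPreBrownianReal.measure_zero_or_one_of_scaleInvariant`, an event `E` that coincides a.s. with
`{B ∈ S}` has probability `0` or `1`. Chaumont–Yor (2003), Exercise 1.8, comment (b).
[cite: ChaumontYor2003, Ex. 1.8] -/
theorem _root_.ProbabilityTheory.IsPreBrownianReal.measure_zero_or_one_of_ae_eq_scaleInvariant
    (hB : IsPreBrownianReal B P) (hm : ∀ t, Measurable (B t))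
    (hcont : ∀ ω, Continuous (B · ω)) (h0 : ∀ ω, B 0 ω = 0)
    {S : Set (ℝ≥0 → ℝ)} (hS : MeasurableSet S)
    (hinv : ∀ c : ℝ≥0, 0 < c → c < 1 → ∀ ω,
      (fun t ↦ (√c)⁻¹ * B (c * t) ω) ∈ S ↔ (fun t ↦ B t ω) ∈ S)
    {E : Set Ω} (hE : E =ᵐ[P] (fun ω t ↦ B t ω) ⁻¹' S) :
    P E = 0 ∨ P E = 1 := by
  rw [measure_congr hE]
  exact hB.measure_zero_or_one_of_scaleInvariant hm hcont h0 hS hinv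

end ScalingZeroOne

end Literature.Probability.Process
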